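import Summits.Ventures.CertifiedManyBodySolver.Theses.CovNdNiO2M21

/-!
# Ventures/CertifiedManyBodySolver — Theorems/CovNdNiO2M21Assembly.lean

The ASSEMBLY item (stmt-Ventures-26753) of the coverage route `CovNdNiO2M21` (hubbard-cov-ndnio2-1; D-0154 (1)(C) «NdNiO₂»,
rung «MOS2-ndnio2-M21»): `ResidualLowUSlab → ResidualHighUSlab → NdNiO2M21_StiffnessBoxCeiling` is the curried form of the route
file's gate-written deciding theorem `closes` (= `NdNiO2M21_StiffnessBoxCeiling_of_cornerCellLeaf le_rfl` ∘ the `le_total U (13/2)` split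
of the residual corner cell `t′ ∈ [−23/50, −11/25] × n ∈ [9/10, 477/500] × U ∈ [5, 17/2]` into its two U-slabs). Filed under `Theorems/`
by hubbard-cov-ndnio2-gen-1 (the route's GENONLY producer seat; captain's WRITE_CRUXES MAP v1, hubbard-obs STATUS 2026-08-28T07:46:56Z:
«any prover lands the assembly one-liner»). Nothing about the two cruxes is claimed here: the theorem is CONDITIONAL on them by
construction (an implication), exactly as the item is typed.

HONEST FRAMING: glue only — certified stiffness CEILINGS on a downfolded SCREENING-GRADE box are CONTROL / CALIBRATION + labelled
heuristic (wording class (xx1)); a ceiling never speaks to the presence of superconductivity; not a `T_c` or phase statement; no rung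
leaf and no summit statement is proved by this file.
-/

namespace Summit.Ventures.CertifiedManyBodySolver.Theorems

open Summit.Ventures.CertifiedManyBodySolver.Theses.CovNdNiO2M21

/-- The assembly item (stmt-Ventures-26753) of route `CovNdNiO2M21` is a free closure of the route's deciding theorem `closes`:
the low-U slab word and the high-U slab word on the residual corner cell of `boxNdNiO2E_M21` give the registered rung leaf
`NdNiO2M21_StiffnessBoxCeiling`. [cite: ScalapinoWhiteZhang1993, §II] -/
theorem covNdNiO2M21Assembly_proof : Assembly := by
  unfold Assembly
  exact fun h₁ h₂ => closes h₁ h₂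

end Summit.Ventures.CertifiedManyBodySolver.Theorems
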